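import Literature.AlgebraicGeometry.Limits.LocalizationRelativeProperSpread   -- ★ parent: `exists_stage_isProper` (with `[IsProper P.hom]`), §1–§2 plumbing reused by name
import Literature.AlgebraicGeometry.Motives.GoodReduction                    -- ★ `IntegralModel` (§3)
import HarnessLib

/-!
# Properness over a RELATIVE base `P` spreads from the generic stage `P_B` to a finite stage `P_s` — WITHOUT `P → Spec A` proper:
# only the GENERIC FIBRE `P ⊗ Spec B → Spec B` needs to be proper (EGA IV₃ 8.10.5 (xii) ∕ Stacks 081F, the form used by integral models)

Topic `Literature/AlgebraicGeometry/Limits`, namespace `Literature.AlgebraicGeometry.Limits.LocApprox` (§1–§2) and one dot-notation extension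
`Literature.AlgebraicGeometry.Motives.IntegralModel.isProper_snd_specOver` (§3).  THEOREMS ONLY (no definition, no named fact, no instance, no notation,
no `sorry`).  Twin of ★ `Limits/LocalizationRelativeProperSpread` (B-p18 (g37)): there the standing instance `[IsProper P.hom]` is CONSUMED ONLY to know
that the generic stage `P ⊗ Spec B → Spec B` is proper (`MorphismProperty.pullback_snd (P := @IsProper) _ _ inferInstance`, :156 and :223) and that
`P → Spec A` is separated (:184, :232).  Cell `hodgecm-mathlib` (D-0151), P6 «MOD programme» (crux hLiu418 = stmt-HodgeConjecture-24832), P-LINE ED. 2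
«GLOBAL SPREAD» ROAD (S♭) (desk F0P6a-plan (g4) `MEMO-PLINE-ED2-stubSPREAD.v1` §0, organ **(s1♭)** + **(hP-𝓜)**): GEN՚s global model `𝓜.total → Spec 𝓞_F`
is NOT proper (it lives over `𝓞_F[1∕N]`), but its generic fibre IS (`𝓜.genericIso : 𝓜.total ⊗ F ≅ X`, `X` a proper `F`-scheme), which is all the
spreading argument uses.  HC_CM is proved only modulo the printed citations until rung 0 closes; nothing here is about HC.

THE MATHEMATICS (verbatim the parent's, [EGAIV3] 8.10.5 (xii) ∕ [StacksProject] 081F): `A` a Noetherian domain, `B = Frac A = A_S`, `P → Spec A`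
quasi-compact, quasi-separated, locally of finite presentation and SEPARATED with `P ⊗ Spec B → Spec B` PROPER, `Y → P_t := P ⊗ D(t)` qc∕qs∕l.f.p. with `Y ×_{P_t} P_B → P_B` proper.
Then the total space `Q := (Y → Spec A)` has proper generic fibre `Y ×_{P_t} P_B → P_B → Spec B` (★ §2 squares of the parent); the absolute spread
★ `exists_forall_isProper_snd` gives `Q ×_A D(s) → D(s)` proper at a stage `s ∣`-below `t` (★ §1 of the parent to land in `S`), i.e.
`Y ×_{P_t} P_s → D(s)` proper; cancelling the separated `P_s → D(s)` (Mathlib `IsProper.of_comp`) gives `Y ×_{P_t} P_s → P_s` proper.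
§3: for an integral model `𝓜` of a PROPER `K`-scheme `X` over `R`, `𝓜.total ⊗_R K → Spec K` is proper (it is `𝓜.genericIso.hom ≫ X.hom`).

* §1 **`exists_stage_isProper_of_isProper_generic`** — the parent's `exists_stage_isProper` with `[IsProper P.hom]` replaced by `[IsSeparated P.hom]`
  `(hP : IsProper (pullback.snd P.hom (specOver A B).hom))`;
* §2 **`exists_stage_isProper_res_of_isProper_generic`** — the same for the «model over the stage» form `exists_stage_isProper_res`;
* §3 **`IntegralModel.isProper_snd_specOver`** (hP-𝓜) — the hypothesis `hP` for `P := 𝓜.total`.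

## References
* [EGAIV3] A. Grothendieck, J. Dieudonné, EGA IV₃ (Publ. Math. IHÉS 28, 1966), Thm. 8.10.5 (xii).
* [StacksProject] The Stacks Project, Tag 081F (properness descends through a limit), Tag 01W6 (`f` proper if `g ∘ f` proper and `g` separated).
* [GortzWedhorn2020] U. Görtz, T. Wedhorn, *Algebraic Geometry I*, 2nd ed. (2020), Section (4.7) (pp. 107–108) (base change), p. 434 (IND) with [EGAIV] (8.10.5).
* [SerreTate1968] J.-P. Serre, J. Tate, *Good reduction of abelian varieties*, Ann. of Math. 88 (1968), §1 (integral models).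
-/

set_option autoImplicit false

noncomputable section

universe u

open CategoryTheory CategoryTheory.Limits AlgebraicGeometry MonoidalCategory CartesianMonoidalCategory

namespace Literature.AlgebraicGeometry.Limits

namespace LocApprox

open Literature.AlgebraicGeometry.Motives (SchemeOver specOver)

set_option backward.isDefEq.respectTransparency false

/-! ## §1 Properness spreads from `P_B` to a stage `P_s` when the generic stage `P_B → Spec B` is proper -/

section Proper

variable {A : Type u} [CommRing A] {S : Submonoid A} {B : Type u} [CommRing B] [Algebra A B] [IsLocalization S B]
  (P : SchemeOver A) [QuasiCompact P.hom] [QuasiSeparated P.hom] [LocallyOfFinitePresentation P.hom]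

/-- **PROPERNESS OVER `P` SPREADS FROM THE GENERIC STAGE TO A FINITE STAGE, for `P` separated with PROPER GENERIC FIBRE** ([EGAIV3] 8.10.5 (xii),
[StacksProject] 081F): `A` a Noetherian domain, `B = Frac A = A_S`, `P → Spec A` qc∕qs and separated with `P ⊗ Spec B → Spec B` proper (`hP`),
`P` locally of finite presentation (the parent got finite type from properness), `Y → P ⊗ D(t)` qc∕qs∕l.f.p. with `Y ×_{P_t} P_B → P_B` proper; then
`Y ×_{P_t} P_s → P_s` is proper for some stage `s → t`.  The proof of ★ `exists_stage_isProper` with its one use of `[IsProper P.hom]` replaced by `hP`. [cite: EGAIV3, Thm. 8.10.5 (xii)] [cite: StacksProject, Tag 081F] -/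
theorem exists_stage_isProper_of_isProper_generic [IsDomain A] [IsNoetherianRing A] [IsFractionRing A B] [IsSeparated P.hom]
    (hP : IsProper (pullback.snd P.hom (specOver A B).hom)) {t : Idx S}
    (Y : Over (P ⊗ (baseDiagram S).obj t).left) [QuasiCompact Y.hom] [QuasiSeparated Y.hom] [LocallyOfFinitePresentation Y.hom]
    (h : IsProper (pullback.snd Y.hom (P ◁ (baseCone S B).π.app t).left)) :
    ∃ (s : Idx S) (ρ : s ⟶ t), IsProper (pullback.snd Y.hom (P ◁ (baseDiagram S).map ρ).left) := by
  haveI : Nontrivial B := (IsFractionRing.injective A B).nontrivial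
  letI : Field B := IsFractionRing.toField A
  -- the total space `Q := (Y → P_t → Spec A)`, a qc/qs/l.f.p. `A`-scheme
  let Q : SchemeOver A := Over.mk (Y.hom ≫ (P ⊗ (baseDiagram S).obj t).hom)
  haveI : QuasiCompact Q.hom := by change QuasiCompact (Y.hom ≫ _); infer_instance
  haveI : QuasiSeparated Q.hom := by change QuasiSeparated (Y.hom ≫ _); infer_instance
  haveI : LocallyOfFinitePresentation Q.hom := by change LocallyOfFinitePresentation (Y.hom ≫ _); infer_instance
  -- its generic fibre is `Y ×_{P_t} P_B → P_B → Spec B`, proper (here `hP` replaces `[IsProper P.hom]`)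
  have hB := isPullback_fst_snd_comp_snd_hom P ((baseCone S B).π.app t) Y
  have hcomp : IsProper (pullback.snd Y.hom (P ◁ (baseCone S B).π.app t).left ≫ pullback.snd P.hom (specOver A B).hom) :=
    MorphismProperty.comp_mem @IsProper _ _ h hP
  have hgen : IsProper (pullback.snd Q.hom (Spec.map (CommRingCat.ofHom (algebraMap A B)))) := by
    have e : hB.isoPullback.hom ≫ pullback.snd Q.hom (Spec.map (CommRingCat.ofHom (algebraMap A B))) =
        pullback.snd Y.hom (P ◁ (baseCone S B).π.app t).left ≫ pullback.snd P.hom (specOver A B).hom :=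
      hB.isoPullback_hom_snd
    have key : IsProper (hB.isoPullback.hom ≫ pullback.snd Q.hom (Spec.map (CommRingCat.ofHom (algebraMap A B)))) := by
      rw [e]; exact hcomp
    exact (MorphismProperty.cancel_left_of_respectsIso @IsProper _ _).mp key
  -- the absolute spread on `Q`
  obtain ⟨s₀, hs₀, H⟩ := exists_forall_isProper_snd B Q hgen
  -- land in `S`: `s₀ ∣ m ∈ S`, stage `s := t·m`
  have hu : IsUnit (algebraMap A B s₀) := IsUnit.mk0 _ (IsFractionRing.to_map_ne_zero_of_mem_nonZeroDivisors hs₀)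
  obtain ⟨m, hmS, hsm⟩ := exists_mem_dvd_of_isUnit S B hu
  let s : Idx S := ⟨t.val * m, S.mul_mem t.mem hmS⟩
  have hst : s ≤ t := Idx.le_iff.mpr (dvd_mul_right _ _)
  refine ⟨s, homOfLE hst, ?_⟩
  -- `Q ×_A D(s) → D(s)` is proper
  have hQs : IsProper (pullback.snd Q.hom ((baseDiagram S).obj s).hom) :=
    H s.val (mem_nonZeroDivisors_of_mem S B s.mem) (dvd_trans hsm (dvd_mul_left _ _)) (loc S s)
  -- read it as `Y ×_{P_t} P_s → D(s)` and cancel the separated `P_s → D(s)`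
  have hS' := isPullback_fst_snd_comp_snd_hom P ((baseDiagram S).map (homOfLE hst)) Y
  let g₁ : pullback Y.hom (P ◁ (baseDiagram S).map (homOfLE hst)).left ⟶ (P ⊗ (baseDiagram S).obj s).left :=
    pullback.snd Y.hom (P ◁ (baseDiagram S).map (homOfLE hst)).left
  let g₂ : (P ⊗ (baseDiagram S).obj s).left ⟶ ((baseDiagram S).obj s).left := pullback.snd P.hom ((baseDiagram S).obj s).hom
  have e : hS'.isoPullback.hom ≫ pullback.snd Q.hom ((baseDiagram S).obj s).hom = g₁ ≫ g₂ := hS'.isoPullback_hom_snd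
  haveI : IsProper (g₁ ≫ g₂) := by
    rw [← e]
    exact (MorphismProperty.cancel_left_of_respectsIso @IsProper _ _).mpr hQs
  haveI : IsSeparated g₂ := MorphismProperty.pullback_snd (P := @IsSeparated) _ _ inferInstance
  exact IsProper.of_comp g₁ g₂

/-! ## §2 The «model over the stage» form -/

omit [QuasiCompact P.hom] [QuasiSeparated P.hom] [LocallyOfFinitePresentation P.hom] in
/-- **PROPERNESS OVER `P` SPREADS — «MODEL OVER THE STAGE» FORM, for `P` separated with proper generic fibre**: `A` a Noetherian domain,
`B = Frac A = A_S`, `P → Spec A` separated with `P ⊗ Spec B → Spec B` proper (`hP`), `Y → Spec A` qc∕qs∕l.f.p. with a model `h : Y ⊗ D(t) ⟶ P ⊗ D(t)`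
over `D(t)` and a generic value `hB : Y ⊗ Spec B ⟶ P ⊗ Spec B` over `Spec B` with `hB.left` PROPER: then `(res ρ h).left` is proper for some
`ρ : s ⟶ t` (the proof of ★ `exists_stage_isProper_res` with `hP` for `[IsProper P.hom]`). [cite: EGAIV3, Thm. 8.10.5 (xii)] [cite: StacksProject, Tag 081F] -/
theorem exists_stage_isProper_res_of_isProper_generic [IsDomain A] [IsNoetherianRing A] [IsFractionRing A B] [IsSeparated P.hom]
    (hP : IsProper (pullback.snd P.hom (specOver A B).hom))
    {Y : SchemeOver A} [QuasiCompact Y.hom] [QuasiSeparated Y.hom] [LocallyOfFinitePresentation Y.hom] {t : Idx S}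
    (h : Y ⊗ (baseDiagram S).obj t ⟶ P ⊗ (baseDiagram S).obj t)
    (hB : Y ⊗ specOver A B ⟶ P ⊗ specOver A B) (hhB : hB ≫ snd _ _ = snd _ _) (hprop : IsProper hB.left) :
    ∃ (s : Idx S) (ρ : s ⟶ t), IsProper (res ρ h).left := by
  -- the generic fibre `Y ⊗ Spec B → Spec B` is `hB ≫ snd`, proper
  have hgen : IsProper (pullback.snd Y.hom (specOver A B).hom) := by
    have e : (snd Y (specOver A B)).left = hB.left ≫ (snd P (specOver A B)).left := by
      rw [← Over.comp_left, hhB]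
    have e' : pullback.snd Y.hom (specOver A B).hom = hB.left ≫ pullback.snd P.hom (specOver A B).hom := e
    rw [e']
    exact MorphismProperty.comp_mem @IsProper _ _ hprop hP
  obtain ⟨s, ρ, hs⟩ := exists_stage_le_isProper_snd (B := B) Y hgen t
  refine ⟨s, ρ, ?_⟩
  let g₁ : (Y ⊗ (baseDiagram S).obj s).left ⟶ (P ⊗ (baseDiagram S).obj s).left := (res ρ h).left
  let g₂ : (P ⊗ (baseDiagram S).obj s).left ⟶ ((baseDiagram S).obj s).left := (snd P ((baseDiagram S).obj s)).left
  have e : g₁ ≫ g₂ = pullback.snd Y.hom ((baseDiagram S).obj s).hom := by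
    change (res ρ h).left ≫ (snd P ((baseDiagram S).obj s)).left = (snd Y ((baseDiagram S).obj s)).left
    rw [← Over.comp_left, res_snd]
  haveI : IsProper (g₁ ≫ g₂) := by rw [e]; exact hs
  haveI : IsSeparated g₂ := MorphismProperty.pullback_snd (P := @IsSeparated) _ _ inferInstance
  exact IsProper.of_comp g₁ g₂

end Proper

end LocApprox

end Literature.AlgebraicGeometry.Limits

/-! ## §3 (hP-𝓜) The generic fibre of an integral model of a proper scheme is proper -/

namespace Literature.AlgebraicGeometry.Motives

namespace IntegralModel

variable {R K : Type u} [CommRing R] [Field K] [Algebra R K] {X : SchemeOver K}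

/-- **(hP-𝓜) The generic stage of an integral model of a PROPER `K`-scheme is proper**: for `𝓜 : IntegralModel R K X` with `X → Spec K` proper,
`𝓜.total ×_R Spec K → Spec K` is proper — it is `𝓜.genericIso.hom.left ≫ X.hom` (an isomorphism followed by a proper map; Mathlib
`MorphismProperty.cancel_left_of_respectsIso`).  The hypothesis `hP` of §1–§2 for GEN՚s global model `P := 𝓜.total`. [cite: SerreTate1968, §1] -/
theorem isProper_snd_specOver (𝓜 : IntegralModel R K X) [hX : IsProper X.hom] :
    IsProper (pullback.snd 𝓜.total.hom (specOver R K).hom) := by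
  have e : 𝓜.genericIso.hom.left ≫ X.hom = pullback.snd 𝓜.total.hom (specOver R K).hom := Over.w 𝓜.genericIso.hom
  haveI : IsIso 𝓜.genericIso.hom.left := (inferInstance : IsIso ((Over.forget _).mapIso 𝓜.genericIso).hom)
  rw [← e]
  exact (MorphismProperty.cancel_left_of_respectsIso @IsProper 𝓜.genericIso.hom.left X.hom).mpr hX

end IntegralModel

end Literature.AlgebraicGeometry.Motives

end
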